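import Mathlib
import HarnessLib
import HarnessLib.Audit
import Summits.Parity.Statement
import Literature.NumberTheory.Sieve.NSqAddOneCubeCorner
import Literature.NumberTheory.LFunctions.ExceptionalCharacters
import Literature.NumberTheory.Sieve.ParityWave0
import Literature.NumberTheory.Sieve.ParityBatemanHorn
import Summits.Parity.BatemanHorn.Theorems.SoloInformedLargeDivisorTiers
import Literature.Barriers.Parity.SiegelZeroDichotomy
import Summits.Parity.BatemanHorn.Theorems.LandauConjecture
import HarnessLib.Audit.Status.Attr

/-!
Route: IllusoryCubeCorner

DORMANT since 2026-08-27T11:15:06Z (@run/shared/lean/pub/parity-ideate/parity-ideate-p2/dormant-note-IllusoryCubeCorner.txt) — unstaffed, not closed; items shared with open routes are served there. `ledger route dormant <id> --off` reactivates.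

# Route IllusoryCubeCorner — exceptional characters give n²+1 primes once the ternary-divisor cube
corner along ℓ²+1 is known

RUNG ROUTE (D-0059/D-0061, class rung, rung F-P1; closes the rung leaf = this route's TARGET item
`ExceptionalCharactersNSqAddOnePrimes := (∀ A,
Literature.NumberTheory.LFunctions.ExceptionalCharactersOfStrength A) → LandauConjecture`
("exceptional characters of every strength give infinitely many primes n² + 1"), to be registered as
the rung's ALT-CLOSER by its FQN
`Summit.Parity.BatemanHorn.Theses.IllusoryCubeCorner.ExceptionalCharactersNSqAddOnePrimes` — a
CONDITIONAL INSTRUMENT on the Siegel-zero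
branch of the dichotomy, never summit credit; until the registration the gate reads `closes` as
conclusion-mismatch and the route is DRAFT
by design, exactly like the cell's p3 routes). It suffices to show X = X1 ∧ X2 ∧ X3: X1
(CubeCornerTw, K1c-tw) the power-saving ternary-divisor asymptotic along `ℓ² + 1` at the
cube corner `e, f, g ≥ X^{1/2-η₁}` in sub-dyadic boxes with all congruence twists `ℓ ≡ t, e ≡ a, f ≡
b, g ≡ r (mod q)`, uniformly for `q ≤ X^δ`; X2 (GM25ResidueTwists, K1⁺)
Grimmelt–Merikoski's Type-I estimate for roots of `ℓ² + 1` with the modulus in residue classes `mod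
D₀ ≤ X^δ`; X3 (IllusoryAsymptoticNSqAddOne)
the Friedlander–Iwaniec illusory sieve run on `n² + 1`: X1 and X2 plus exceptional characters of
every strength give `π_E(x) ≥ c·x/log x`
for the `x` in the illusory ranges of infinitely many exceptional moduli, hence frequently. The glue
is the tree lemma
`Summit.Parity.BatemanHorn.Theorems.landauConjecture_of_frequently_primeCount_ge`. All objects and
statement SHAPES are Literature
(`Literature.NumberTheory.Sieve.NSqAddOneCorner.*`, p409703;
`Literature.NumberTheory.LFunctions.ExceptionalCharactersOfStrength`, p409519 —
landed by the cell's literature seat from this seat's refereed leaf texts, with `Iff.rfl`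
certificates that every item below is its leaf body).
Lean: `(∃ η₁ : ℝ, 0 < η₁ ∧ ∃ δ : ℝ, 0 < δ ∧ ∃ C X₀ : ℝ,
Literature.NumberTheory.Sieve.NSqAddOneCorner.CubeCornerTwBoundWith (1 / 2 - η₁) δ C X₀) ∧ (∀ ε : ℝ,
0 < ε → ∃ δ : ℝ, 0 < δ ∧ ∃ J : ℕ, ∃ X₀ : ℝ,
Literature.NumberTheory.Sieve.NSqAddOneCorner.GM25TypeIResidueClassesWith ε δ J X₀) ∧ ((∃ η₁ : ℝ, 0
< η₁ ∧ ∃ δ : ℝ, 0 < δ ∧ ∃ C X₀ : ℝ,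
Literature.NumberTheory.Sieve.NSqAddOneCorner.CubeCornerTwBoundWith (1 / 2 - η₁) δ C X₀) → (∀ ε : ℝ,
0 < ε → ∃ δ : ℝ, 0 < δ ∧ ∃ J : ℕ, ∃ X₀ : ℝ,
Literature.NumberTheory.Sieve.NSqAddOneCorner.GM25TypeIResidueClassesWith ε δ J X₀) → (∀ A : ℝ,
Literature.NumberTheory.LFunctions.ExceptionalCharactersOfStrength A) → ∃ c : ℝ, 0 < c ∧ ∃ᶠ x : ℕ in
Filter.atTop, c * (x : ℝ) / Real.log (x : ℝ) ≤ (Literature.NumberTheory.Sieve.nSqAddOnePrimeCount x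
: ℝ))`

## Assembly
Pure logic plus one tree lemma: X3 applied to X1, X2 and the target's hypothesis `∀ A,
ExceptionalCharactersOfStrength A` gives `c > 0` with
`c·x/log x ≤ π_E(x)` frequently;
`Summit.Parity.BatemanHorn.Theorems.landauConjecture_of_frequently_primeCount_ge` (file
`SoloInformedLargeDivisorTiers`) turns that into `LandauConjecture`, i.e. the target `(∀ A,
ExceptionalCharactersOfStrength A) → LandauConjecture`.
The deciding theorem `closes (h1 : CubeCornerTw) (h2 : GM25ResidueTwists) (h3 :
IllusoryAsymptoticNSqAddOne) : ExceptionalCharactersNSqAddOnePrimes`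
in glue.lean proves the Assembly item and applies it (cone: every crux is a consumed binder,
Assembly and the target are in the cone). Until the
target is registered as ALT-CLOSER the gate reads this as conclusion-mismatch (DRAFT by design);
`ledger route edit <id> --closes-target
Summit.Parity.BatemanHorn.Theses.IllusoryCubeCorner.ExceptionalCharactersNSqAddOnePrimes
--closes-file glue.lean` then serves it.

CLOSES_TARGET: closes rung F-P1.DoorA of Parity: Summit.Parity.BatemanHorn.Theses.IllusoryCubeCorner.ExceptionalCharactersNSqAddOnePrimes (D-0061; not the summit Statement) — the deciding theorem of this route concludes that registered leaf instead of the Statement decl `BatemanHorn` (class rung: servable and labelled, never counted as concluding the summit Statement).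

Rationale: WHY THIS LINE. Friedlander–Iwaniec's illusory sieve (FriedlanderIwaniec2005IllusorySieve; survey
FriedlanderIwaniec2022; Heath-Brown's prototype
HeathBrown1983PrimeTwins) turns an exceptional character `χ (mod D)` into a parity-sensitive sieve:
`λ = 1 ∗ χ` is lacunary on primes, so an
asymptotic for primes in a sequence 𝒜 follows from DIVISOR-type sums of 𝒜 (level beyond `x^{1/2}`
replaces every Type-II input); for primes
in progressions the decisive input was `τ₃` in APs to level `x^{1/2+δ}` (FI 1985 via Deligne), and
Merikoski2024ExceptionalCharacters ran the
scheme for two-variable polynomial sequences. For the one-variable quadratic `n² + 1` (density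
`X^{-1/2}` among `m ≤ X²`) the divisor input
the scheme needs is the ternary-divisor asymptotic along `ℓ² + 1` with the modulus `ef ∈ [X,
X^{3/2}]` BEYOND the length `X` — the cube
corner K1c, which Merikoski2022 (§4) names as the open Type-I₂ problem and which no
level-of-distribution result in print reaches
(GrimmeltMerikoski2025 stop at level `X^{1-ε}`; BretecheDrappeau2017, Pascadi2026 likewise).
Imported areas: spectral theory of
automorphic forms (Kuznetsov / large sieve for roots of quadratic congruences:
DukeFriedlanderIwaniec1995, GrimmeltMerikoski2025) for X1/X2,
exceptional-character sieve technology for X3. No prior route of the summit touches the Siegel-zero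
branch for `n² + 1`
(`Literature.Barriers.Parity.SiegelZeroDichotomy` records twins and Goldbach only), and nothing in
`ledger negatives --problem Parity`
(4 entries: two Gallagher/variance constants, two sieve-weight statements) bears on divisor sums
along quadratics.

RANKED CRUXES. #0 ExceptionalCharactersNSqAddOnePrimes (target) — the rung leaf itself, as this
route's target item (rung F-P1 / p1 Door A; to be registered as the rung's ALT-CLOSER by FQN,
D-0061): exceptional characters of EVERY strength — for every `A`, primitive quadratic `χ (mod q)`
with `q → ∞` and `‖L(1,χ)‖ ≤ (log q)^{-A}` (`∀ A,
Literature.NumberTheory.LFunctions.ExceptionalCharactersOfStrength A`, p409519; = the cell's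
`LacunaryExceptionalCharacters` by `Iff.rfl`) — imply Landau's conjecture (`n² + 1` prime infinitely
often). The `n² + 1` analogue of Heath-Brown's "Siegel zeros ⇒ twin primes" in Friedlander–Iwaniec's
illusory-sieve form; NOT in print; expected FALSE hypothesis under GRH (then the item holds
vacuously — its content is the unconditional implication, like
`Literature.Barriers.Parity.SiegelZeroTwinPrimes`). (why it might fail: it is decided by this
route's three cruxes; on its own it fails only if the illusory sieve cannot be fed for a
density-X^{-1/2} one-variable sequence at all (FI05/Merikoski24 need two variables or linear
structure) — i.e. iff crux 3 fails with cruxes 2, 4 as hypotheses.)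
[FriedlanderIwaniec2005IllusorySieve, HeathBrown1983PrimeTwins, Merikoski2024ExceptionalCharacters,
FriedlanderIwaniec2022, arXiv:2108.01355]
#2 CubeCornerTw (crux) — K1c-tw (cell parity-ideate p1; shape
`Literature.NumberTheory.Sieve.NSqAddOneCorner.CubeCornerTwBoundWith θ δ C X₀` at `θ = 1/2 - η₁`,
p409703): for some `η₁, δ > 0`, uniformly for `q ≤ X^δ` and all residue classes `t, a, b, r (mod
q)`, for sub-dyadic boxes `e ∈ (E₁,E₂], f ∈ (F₁,F₂], g ∈ (G₁,G₂]` with `E₁, F₁, G₁ ≥ X^{1/2-η₁}`,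
`X²/64 ≤ E₁F₁G₁ ≤ X²`, the count `cornerCountTw` of `ℓ ≤ X, ℓ ≡ t` with `efg = ℓ² + 1`, `e ≡ a, f ≡
b, g ≡ r (mod q)` equals the CRT model `cornerModelTw` (local density `twistedRootCount q t r
(ef)/(q·ef)`) up to `O(X^{1-δ})` — power saving at the cube corner, where the modulus `ef ≥
X^{1-2η₁}` of the completed `ℓ`-sum exceeds every level in print (no additive twist: the sieve's `c
∣ k` and character classes are congruence conditions). [difficulty: XL] (why it might fail: For E ≥
X^{1/2} every method in print (Kuznetsov / spectral large sieve per level e, Hooley–Tóth–GM) loses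
to the Parseval term E·X^{1/2} ≥ X; power saving at e=f=g=X^{2/3} needs cancellation ACROSS the
level e, which nothing in print supplies (Merikoski2022 §4: open Type-I₂ problem).) [Merikoski2022,
GrimmeltMerikoski2025, DukeFriedlanderIwaniec1995, BretecheDrappeau2017, Pascadi2026,
arXiv:1908.08816, arXiv:2505.00493]
#3 IllusoryAsymptoticNSqAddOne (crux) — the illusory sieve for `n² + 1`: given K1c-tw (the first
hypothesis is item `CubeCornerTw` verbatim) and K1⁺ (the second is item `GM25ResidueTwists`
verbatim; both spelled out so the item stands alone), exceptional characters of every strength (for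
all `A`, primitive quadratic `χ (mod q)`, `q → ∞`, with `‖L(1,χ)‖ ≤ (log q)^{-A}`) yield `c > 0`
with `#{n ≤ x : n² + 1 prime} ≥ c·x/log x` for the `x` in the illusory ranges `[q^{c₁}, q^{c₂}]` of
infinitely many exceptional moduli — hence frequently in `x`. This is Friedlander–Iwaniec's theorem
shape (asymptotic for `x` between two powers of the exceptional modulus) transplanted from
arithmetic progressions to the quadratic sequence, with K1c-tw/K1⁺ in the role of `τ₃` in APs.
[deps: CubeCornerTw, GM25ResidueTwists] [difficulty: XL] (why it might fail: FI's remainder for a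
density-X^{-1/2} sequence may need twisted τ₃-type sums outside K1cTw's boxes (cofactor below
X^{1/2-η₁}, or moduli q beyond X^δ), or control of primes p | ℓ²+1 with χ(p)=1 in a middle range
that lacunarity alone does not remove (FI05 §§6–9 use the linear structure of APs).)
[FriedlanderIwaniec2005IllusorySieve, HeathBrown1983PrimeTwins, Merikoski2024ExceptionalCharacters,
FriedlanderIwaniec2022, arXiv:2108.01355]
#4 GM25ResidueTwists (crux) — K1⁺ (shape
`Literature.NumberTheory.Sieve.NSqAddOneCorner.GM25TypeIResidueClassesWith ε δ J X₀`, p409703): the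
conclusion of Grimmelt–Merikoski 2025 Theorem 1.4 for roots of `ℓ² + 1` in the restricted range `K ≤
D·X^{1+δ}` (`Literature.NumberTheory.Sieve.grimmeltMerikoski2025_thm14_restricted_one`) with the
smooth modulus `k` additionally restricted to a residue class `k ≡ k₀ (mod D₀)`, uniformly for `D₀ ≤
X^δ`, same bound `X^ε · D X^{1/2} (1 + X/D²)^{7/64}`; at `D₀ = 1` it is literally the named fact
(`Literature.NumberTheory.Sieve.NSqAddOneCorner.gm25TypeIResidueClassesWith_one`, landed).
[difficulty: L] (why it might fail: Detecting k ≡ k₀ (D₀) by characters mod D₀ moves GM25's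
Kuznetsov step to level ·D₀² with nebentypus and costs D₀^{O(1)}; X^ε absorbs it only if the
exponent is fixed, and the exceptional-eigenvalue (7/64) loss or the Gauss–Tóth factorisation may
not stay uniform up to D₀ = X^δ.) [GrimmeltMerikoski2025, DukeFriedlanderIwaniec1995, Pascadi2026,
arXiv:2505.00493]

TWO-LAYER PLAN. Foreseen glued splits (nothing filed now). CubeCornerTw ⇐ SubLength → SuperLength →
CubeCornerTw, split by the modulus `q·e·f` of the
ℓ-progressions against the length X (birth skeleton `bc/CubeCornerTw_birth.lean` rev 2, rc 0,
sorries = stubs, composition `CubeCornerTw_of`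
PROVED with `min η₁, min δ, max C, max X₀`): SubLength = the boxes `E₁F₁ ≤ X^{9/10}` — ELEMENTARY
(the admissible ℓ form
`twistedRootCount q t r (ef)` classes mod `q·e·f < X`, each meets the ℓ-interval in `|I|/(qef) +
O(1)` points; `O(1)` summed over `≤ 4EF/q²`
pairs is `≪ X^{9/10+ε}`; provable now, M-sized floor/sqrt bookkeeping); SuperLength = the boxes
`E₁F₁ > X^{9/10}` — THE CRUX PROPER (modulus
beyond the length in every pairing of the three factors; per pair even square-root cancellation in
the dual frequency sum gives
`(X/qef)^{1/2}`, total `(EF·X)^{1/2}/q^{5/2} > X^{1-δ}`, so cancellation ACROSS the structured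
moduli `e·f` — a dispersion / bilinear-Kloosterman
input not in print — is forced). The dual object `twistedRootWeylSum q t r k h = Σ_{ν mod qk: ν≡t
(q), k∣ν²+1, (ν²+1)/k≡r (q)} e(hν/(qk))` is
recorded in the skeleton; NO dual-side intermediate is typed (rev 1's `DualTwBound`, norms inside
the (e,f,h)-sums, was FALSE — erratum in the
skeleton header — and the exact finite-Fourier dual form is equivalent to the crux).
GM25ResidueTwists ⇐ CharTwist → Orthogonality → GM25ResidueTwists: CharTwist =
GM25 Thm 1.4 (restricted) with a Dirichlet character `χ (mod D₀)` on the modulus, Orthogonality =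
characters mod D₀ detect the class.
IllusoryAsymptoticNSqAddOne ⇐ IllusoryRange → RangesToFrequently → IllusoryAsymptoticNSqAddOne:
IllusoryRange = FI's theorem for ONE
exceptional character of fixed strength A₀ with explicit range `q^{c₁} ≤ x ≤ q^{c₂}`;
RangesToFrequently = bookkeeping from
`∀ A, ExceptionalCharactersOfStrength A` (moduli → ∞) to `∃ᶠ x`.

KILL CRITERIA. Refuting CubeCornerTw (a family of boxes at the corner where count and model differ
by ≫ X^{1-o(1)}, e.g. from a secondary main term the
CRT model misses) closes the route outright (`--reason refuted:CubeCornerTw`) unless the refutation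
is of the model only (then restate with the
corrected model: misstated). Refuting GM25ResidueTwists for D₀ = X^δ but not for D₀ ≤ (log X)^B
forces a pivot to a log-power version (the
illusory sieve needs only moduli q ≤ (log x)^{O(1)}·D^{O(1)}). Refuting IllusoryAsymptoticNSqAddOne
with X1, X2 kept as hypotheses (i.e. showing FI's
remainder genuinely needs cofactors below X^{1/2-η₁}) forces a pivot to a wider corner statement (E₁
≥ X^{1/2-η₁} replaced by E₁ ≥ X^{γ}) or
retires the line. A proof of `Literature.NumberTheory.LFunctions.NoSiegelZeros` makes the target
vacuously true and the route moot
(it is an instrument on the other branch: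
`Literature.NumberTheory.LFunctions.not_exceptionalCharactersOfStrength_of_noSiegelZeros`, landed);
a proof of LandauConjecture moots it (the target is `fun _ => h`).

NOT DECOMPOSED YET. The sieve bookkeeping inside IllusoryAsymptoticNSqAddOne (choice of `(c₁, c₂,
A₀)`, the fundamental-lemma presieve, the partition of the
divisor range into K1⁺ boxes (modulus ≤ X^{1-ε}) and K1c-tw boxes (corner), the lacunary B⁺
remainder) is deliberately one crux: its
constants are only meaningful once CubeCornerTw's `(η₁, δ)` are known. The sub-length / super-length
regimes of CubeCornerTw are layer-2
children (Two-layer plan); no dual-side intermediate is typed. No definition requests: all objects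
(`cornerCountTw`, `cornerModelTw`,
`twistedRootCount`, `typeISumAP`) and statement shapes are in
`Literature.NumberTheory.Sieve.NSqAddOneCubeCorner` (p409703, landed), the
exceptional-character hypothesis in `Literature.NumberTheory.LFunctions.ExceptionalCharacters`
(p409519, landed).

CHEAPEST FALSIFIER. For CubeCornerTw: the q = 1 sliver `X^{1/2-η₁} ≤ E₁ ≤ X^{1/2-η₁/2}` must agree
with GM25 Thm 1.4 + partition of unity (it does:
planned BC5 rung, `bc/CubeCornerTw_birth.lean: stub_rung_sliver`); numerically, the cell's dual-sum
tables (kit jobs j242711, j243116, j244398, j244592, all done: the rms over 0 < |h| ≤ H of the e~E,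
f~F-summed twisted root-Weyl sums sits at (0.84–0.96)·√V of the exact independent-root-phase
variance V, FLAT in K = EF from 6.6·10⁴ to 9·10¹⁰ — square-root size, no secondary main term) would
have shown a model mismatch or a growing ratio at once. For GM25ResidueTwists: D₀ = 1 is the named
fact (`Literature.NumberTheory.Sieve.NSqAddOneCorner.gm25TypeIResidueClassesWith_one`, landed; the
route-level rung
`bc/GM25ResidueTwists_rung.lean`). For the whole line: Heath-Brown's twin-prime theorem under Siegel
zeros (HeathBrown1983PrimeTwins) is the
existence proof that the scheme closes for a density-comparable problem once the divisor input is
available.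

NUMBERS. Levels in print for divisor-type sums along `ℓ² + 1` (modulus d ≤ X^{θ}, length X): θ = 1 -
ε (GrimmeltMerikoski2025 Thm 1.4, smooth weights;
BretecheDrappeau2017 Lemme 9.3 well-factorable 1 - ε; Pascadi2026 p. 32 improves the dependence on
the exceptional eigenvalue, θ_max = 7/64).
The corner needs θ ∈ [1, 4/3 + 2η₁] for the modulus ef (cofactor g ≥ X^{1/2-η₁}). Parseval ceiling
of the spectral large sieve for level e and
length X: error ≍ (eX)^{1/2}·X^{o(1)} per modulus, i.e. no saving once e ≥ X (cell ROUND-2 §S6; GM25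
§5). FI's AP theorem: asymptotic for
`x` in `[D^{a}, D^{b}]` with explicit absolute `a < b` given an exceptional χ mod D with `L(1,χ) ≤
(log D)^{-A}` (FriedlanderIwaniec2005IllusorySieve,
Thm 1.1 shape; HeathBrown1983PrimeTwins: twins for `q^{300} ≤ x ≤ q^{500}`-type ranges).

DEFINITION REQUESTS. None. Everything the items name is landed Literature:
`Literature/NumberTheory/Sieve/NSqAddOneCubeCorner.lean` (p409703, namespace
`Literature.NumberTheory.Sieve.NSqAddOneCorner`: defs `cornerCount`, `cornerModel`,
`twistedRootCount`, `cornerCountTw`, `cornerModelTw`,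
`typeISumAP`; shapes `CubeCornerBoundWith`, `CubeCornerTwBoundWith`, `CubeCornerTwLogBoundWith`,
`GM25TypeIResidueClassesWith`; proved
identities `cornerCount_eq_sum_tw`, `cornerModel_eq_sum_tw`, `sum_sum_twistedRootCount_eq`,
`typeISumAP_modulus_one`, the D₀ = 1 rung
`gm25TypeIResidueClassesWith_one`, five `Iff.rfl` certificates against this seat's refereed leaf
texts rev 2/3) and
`Literature/NumberTheory/LFunctions/ExceptionalCharacters.lean` (p409519:
`ExceptionalCharactersOfStrength A` + the PROVED Siegel-branch
edge `unboundedSiegelZeros_of_exceptionalCharactersOfStrength_three`). The implications between the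
closed corner statements
(K1c-tw ⇒ K1c-η ⇒ K1c, K1c-tw ⇒ K1c-log; this seat's leaf proofs, re-based by the literature seat as
HOME/parity-ideate-lit/wayB/CubeCornerBookkeeping.lean,
rc 0) are route-side bookkeeping, to be landed `--supports CubeCornerTw` after birth.

Novelty: In print, VERBATIM (tribunal J (4)):
[corpus:paper:friedlander2022-exceptional-zeros-sieve-parity-goldbach p.3 L20–27] «In the absence of
a solution to the problem of whether there exist exceptional zeros, there have naturally been
attempts to relate the question to other very difficult problems. One class of results of this type
deals with showing that the assumption of the existence of exceptional zeros leads to consequences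
for prime number distribution that are beyond current reach, but are nevertheless expected to be
true. There have been in recent years quite a number of such results, several by the current
authors; see [Heath-Brown 1983; Friedlander and Iwaniec 2003; 2004; 2005; Merikoski 2021].» — no
one-variable polynomial (n² + 1) in that list. [corpus:paper:arxiv-1908.08816 p.17 L19–26]
(Merikoski) «… for large P one should attempt to obtain some other type of arithmetical information
where the Cauchy-Schwarz inequality is not necessary, eg. an asymptotic for Type I₂ sums Σ_{d ≤ D₂}
λ_d Σ_{m∼M, n∼N, mn ≡ 0 (d)} |A_{mn}| ψ_P(mn) log mn where the most important range would be M = N =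
√P. Even for D₂ = 1 this is an open problem.» — the binary shadow of CubeCornerTw is a NAMED OPEN
problem.
Searches (2026-08-25): `lit search --hybrid "exceptional characters primes of the form n^2+1
illusory sieve Siegel zero" -n 8` (8 rows; relevant:
paper:friedlander2022-exceptional-zeros-sieve-parity-goldbach p.3 = the list
HB83/FI03/FI04/FI05/Merikoski of exceptional-zero-conditiona  [refs: 2108.01355, paper:friedlander2022-exceptional-zeros-sieve-parity-goldbach, paper:arxiv-1908.08816, paper:arxiv-2505.00493, paper:arxiv-2108.01355, GrimmeltMerikoski2025]

Barriers (technique_class: illusory-sieve, quadratic-divisor-sums, large-sieve): - technique_class: illusory-sieve, quadratic-divisor-sums, large-sieve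
- Literature.Barriers.Parity.LargeSieveLevelHalf: BINDING on CubeCornerTw (moduli e·f ≥ length X,
level ∈ [1, 4/3+2η₁]) for every per-modulus method — HOW declared: cancellation ACROSS the
structured moduli e·f (box variables carrying roots of ν² ≡ −1, CRT main terms, no complete-family
character expansion) = the dispersion/Kloosterman evasion the barrier itself lists; UNPROVED, not in
print — this is the crux; no level of distribution for PRIMES is asserted.
- Literature.Barriers.Parity.LargeSieveLevelHalfNarrow: idem, binding on the SuperLength half of
CubeCornerTw; the spectral large sieve enters only inside GM25 (Kuznetsov for quadratic roots,
smooth moduli ≤ X^{1−ε}, 7/64 loss explicit in GM25ResidueTwists), where it is a theorem.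
- Literature.Barriers.Parity.SiegelZeroTwinPrimes: met BY DESIGN — an instrument on the Siegel-zero
branch: hypothesis `∀ A, ExceptionalCharactersOfStrength A` (⇒ UnboundedSiegelZeros, landed p409519;
refuted by NoSiegelZeros), conclusion Landau; vacuous under GRH exactly like this barrier's own twin
statement.
- Literature.Barriers.Parity.SiegelZeroQuadraticPolynomials: consistent, outside — nothing
exceptional-character-BLIND, uniform or effective is claimed; one fixed n² + 1, lower bound c·x/log
x in illusory ranges only (GranvilleMollin2000 Thm 2 is the lever).
- Literature.Barriers.Parity.SelbergParityBarrier: evaded BY HYPOTHESIS (standard since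
HeathBrown1983PrimeTwin

History (route lifecycle, newest last):
- 2026-08-26T00:46:28Z · closes_target -> closes rung F-P1.DoorA of Parity: Summit.Parity.BatemanHorn.Theses.IllusoryCubeCorner.ExceptionalCharactersNSqAddOnePrimes (D-0061; not the summit Statement) (planner-parity-ideate-p1-g5-0)
- 2026-08-27T11:15:06Z · DORMANT — @run/shared/lean/pub/parity-ideate/parity-ideate-p2/dormant-note-IllusoryCubeCorner.txt (operator:999:2885086)

sub-problem: BatemanHorn · status: dormant · opened planner-parity-ideate-p1-g4-0 2026-08-25T22:48:05Z · rev 7 · ledger route-Parity-IllusoryCubeCorner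
GENERATED by the gate from the ledger (D-0016/17). Provers cite these decls: `theorem foo : Summit.Parity.BatemanHorn.Theses.IllusoryCubeCorner.<Decl> := …` in Summits/Parity/BatemanHorn/Theorems/<Name>.lean.
-/

namespace Summit.Parity.BatemanHorn.Theses.IllusoryCubeCorner

open scoped BigOperators Topology Manifold Classical MeasureTheory ProbabilityTheory Matrix InnerProductSpace ComplexConjugate ContinuousMap
open Filter Set Function TopologicalSpace MeasureTheory

attribute [summit_statement] _root_.BatemanHorn
-- H21.Audit: the closer leaf Summit.Parity.BatemanHorn.Theses.IllusoryCubeCorner.ExceptionalCharactersNSqAddOnePrimes is an item decl of this route file — tagged summit_statement below, after its declaration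

-- earlier ExceptionalCharactersNSqAddOnePrimes (stmt-Parity-19873, replaced 2026-08-25T23:25:39Z -> stmt-Parity-20006): retired by None — (∀ A : ℝ, Literature.NumberTheory.LFunctions.ExceptionalCharactersOfStrength A) → Literature.NumberTheory.Sieve.LandauConjecture
/-- item stmt-Parity-20006 · target · rank 0 · open · by planner
why it might fail: it is decided by this route's three cruxes; on its own it fails only if the illusory sieve cannot be fed for a density-X^{-1/2} one-variable sequence at all (FI05/Merikoski24 need two variables or linear structure) — i.e. iff crux 3 fails with cruxes 2, 4 as hypotheses.
sources: FriedlanderIwaniec2005IllusorySieve, HeathBrown1983PrimeTwins, Merikoski2024ExceptionalCharacters, FriedlanderIwaniec2022, arXiv:2108.01355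
[target] the rung leaf itself, as this route's target item (rung F-P1 / p1 Door A; to be registered
as the rung's ALT-CLOSER by FQN, D-0061): exceptional characters of EVERY strength — for every `A`,
primitive quadratic `χ (mod q)` with `q → ∞` and `‖L(1,χ)‖ ≤ (log q)^{-A}` (`∀ A,
Literature.NumberTheory.LFunctions.ExceptionalCharactersOfStrength A`, p409519; = the cell's
`LacunaryExceptionalCharacters` by `Iff.rfl`) — imply Landau's conjecture (`n² + 1` prime infinitely
often). The `n² + 1` analogue of Heath-Brown's "Siegel zeros ⇒ twin primes" in Friedlander–Iwaniec's
illusory-sieve form; NOT in print; expected FALSE hypothesis under GRH (then the item holds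
vacuously — its content is the unconditional implication, like
`Literature.Barriers.Parity.SiegelZeroTwinPrimes`). -/
@[route_item "route-Parity-IllusoryCubeCorner"]
def ExceptionalCharactersNSqAddOnePrimes : Prop :=
  (∀ A : ℝ, Literature.NumberTheory.LFunctions.ExceptionalCharactersOfStrength A) → Summit.Parity.BatemanHorn.LandauConjecture

/-- item stmt-Parity-19874 · crux · rank 2 · open · by planner
why it might fail: For E ≥ X^{1/2} every method in print (Kuznetsov / spectral large sieve per level e, Hooley–Tóth–GM) loses to the Parseval term E·X^{1/2} ≥ X; power saving at e=f=g=X^{2/3} needs cancellation ACROSS the level e, which nothing in print supplies (Merikoski2022 §4: open Type-I₂ problem).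
sources: Merikoski2022, GrimmeltMerikoski2025, DukeFriedlanderIwaniec1995, BretecheDrappeau2017, Pascadi2026, arXiv:1908.08816
[crux] K1c-tw (cell parity-ideate p1; shape
`Literature.NumberTheory.Sieve.NSqAddOneCorner.CubeCornerTwBoundWith θ δ C X₀` at `θ = 1/2 - η₁`,
p409703): for some `η₁, δ > 0`, uniformly for `q ≤ X^δ` and all residue classes `t, a, b, r (mod
q)`, for sub-dyadic boxes `e ∈ (E₁,E₂], f ∈ (F₁,F₂], g ∈ (G₁,G₂]` with `E₁, F₁, G₁ ≥ X^{1/2-η₁}`,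
`X²/64 ≤ E₁F₁G₁ ≤ X²`, the count `cornerCountTw` of `ℓ ≤ X, ℓ ≡ t` with `efg = ℓ² + 1`, `e ≡ a, f ≡
b, g ≡ r (mod q)` equals the CRT model `cornerModelTw` (local density `twistedRootCount q t r
(ef)/(q·ef)`) up to `O(X^{1-δ})` — power saving at the cube corner, where the modulus `ef ≥
X^{1-2η₁}` of the completed `ℓ`-sum exceeds every level in print (no additive twist: the sieve's `c
∣ k` and character classes are congruence conditions). [difficulty: XL] -/
@[route_item "route-Parity-IllusoryCubeCorner", crux]
def CubeCornerTw : Prop :=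
  ∃ η₁ : ℝ, 0 < η₁ ∧ ∃ δ : ℝ, 0 < δ ∧ ∃ C X₀ : ℝ, Literature.NumberTheory.Sieve.NSqAddOneCorner.CubeCornerTwBoundWith (1 / 2 - η₁) δ C X₀

/-- item stmt-Parity-19876 · crux · rank 3 · open · by planner
why it might fail: FI's remainder for a density-X^{-1/2} sequence may need twisted τ₃-type sums outside K1cTw's boxes (cofactor below X^{1/2-η₁}, or moduli q beyond X^δ), or control of primes p | ℓ²+1 with χ(p)=1 in a middle range that lacunarity alone does not remove (FI05 §§6–9 use the linear structure of APs).
sources: FriedlanderIwaniec2005IllusorySieve, HeathBrown1983PrimeTwins, Merikoski2024ExceptionalCharacters, FriedlanderIwaniec2022, arXiv:2108.01355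
[crux] the illusory sieve for `n² + 1`: given K1c-tw (the first hypothesis is item `CubeCornerTw`
verbatim) and K1⁺ (the second is item `GM25ResidueTwists` verbatim; both spelled out so the item
stands alone), exceptional characters of every strength (for all `A`, primitive quadratic `χ (mod
q)`, `q → ∞`, with `‖L(1,χ)‖ ≤ (log q)^{-A}`) yield `c > 0` with `#{n ≤ x : n² + 1 prime} ≥ c·x/log
x` for the `x` in the illusory ranges `[q^{c₁}, q^{c₂}]` of infinitely many exceptional moduli —
hence frequently in `x`. This is Friedlander–Iwaniec's theorem shape (asymptotic for `x` between two
powers of the exceptional modulus) transplanted from arithmetic progressions to the quadratic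
sequence, with K1c-tw/K1⁺ in the role of `τ₃` in APs. [deps: CubeCornerTw, GM25ResidueTwists]
[difficulty: XL] -/
@[route_item "route-Parity-IllusoryCubeCorner", crux]
def IllusoryAsymptoticNSqAddOne : Prop :=
  (∃ η₁ : ℝ, 0 < η₁ ∧ ∃ δ : ℝ, 0 < δ ∧ ∃ C X₀ : ℝ, Literature.NumberTheory.Sieve.NSqAddOneCorner.CubeCornerTwBoundWith (1 / 2 - η₁) δ C X₀) → (∀ ε : ℝ, 0 < ε → ∃ δ : ℝ, 0 < δ ∧ ∃ J : ℕ, ∃ X₀ : ℝ, Literature.NumberTheory.Sieve.NSqAddOneCorner.GM25TypeIResidueClassesWith ε δ J X₀) → (∀ A : ℝ, Literature.NumberTheory.LFunctions.ExceptionalCharactersOfStrength A) → ∃ c : ℝ, 0 < c ∧ ∃ᶠ x : ℕ in Filter.atTop, c * (x : ℝ) / Real.log (x : ℝ) ≤ (Literature.NumberTheory.Sieve.nSqAddOnePrimeCount x : ℝ)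

/-- item stmt-Parity-19875 · crux · rank 4 · open · by planner
why it might fail: Detecting k ≡ k₀ (D₀) by characters mod D₀ moves GM25's Kuznetsov step to level ·D₀² with nebentypus and costs D₀^{O(1)}; X^ε absorbs it only if the exponent is fixed, and the exceptional-eigenvalue (7/64) loss or the Gauss–Tóth factorisation may not stay uniform up to D₀ = X^δ.
sources: GrimmeltMerikoski2025, DukeFriedlanderIwaniec1995, Pascadi2026, arXiv:2505.00493
[crux] K1⁺ (shape `Literature.NumberTheory.Sieve.NSqAddOneCorner.GM25TypeIResidueClassesWith ε δ J
X₀`, p409703): the conclusion of Grimmelt–Merikoski 2025 Theorem 1.4 for roots of `ℓ² + 1` in the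
restricted range `K ≤ D·X^{1+δ}`
(`Literature.NumberTheory.Sieve.grimmeltMerikoski2025_thm14_restricted_one`) with the smooth modulus
`k` additionally restricted to a residue class `k ≡ k₀ (mod D₀)`, uniformly for `D₀ ≤ X^δ`, same
bound `X^ε · D X^{1/2} (1 + X/D²)^{7/64}`; at `D₀ = 1` it is literally the named fact
(`Literature.NumberTheory.Sieve.NSqAddOneCorner.gm25TypeIResidueClassesWith_one`, landed).
[difficulty: L] -/
@[route_item "route-Parity-IllusoryCubeCorner", crux]
def GM25ResidueTwists : Prop :=
  ∀ ε : ℝ, 0 < ε → ∃ δ : ℝ, 0 < δ ∧ ∃ J : ℕ, ∃ X₀ : ℝ, Literature.NumberTheory.Sieve.NSqAddOneCorner.GM25TypeIResidueClassesWith ε δ J X₀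

/-- item stmt-Parity-19996 · aside · rank 9 · open · by planner
[aside] NOT a claim of this route and never to be staffed: Landau's conjecture (n² + 1 prime
infinitely often) occurs in this route ONLY as the CONCLUSION of the target implication
`ExceptionalCharactersNSqAddOnePrimes := (∀ A, ExceptionalCharactersOfStrength A) →
LandauConjecture` (rung leaf F-P1 Door A) and of the tree glue lemma
`landauConjecture_of_frequently_primeCount_ge`; the route proves EC ⇒ Landau and nothing more.
Declared as an item so that the dependency scanner sees the registered conjecture LISTED (gate hint
`undeclared-conjecture` on the born route, 2026-08-25T23:09Z); kind = aside (banked context), to be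
set by --retriage if this add files it otherwise. [source: Literature.NumberTheory.Sieve.ParityWave0
(LandauConjecture, parity.S05); HardyLittlewood1923 Conj. E] -/
@[route_item "route-Parity-IllusoryCubeCorner"]
def Landau : Prop :=
  Literature.NumberTheory.Sieve.LandauConjecture

/-- item stmt-Parity-19877 · assembly · rank 1 · open · by planner
sources: FriedlanderIwaniec2005IllusorySieve, HeathBrown1983PrimeTwins
[assembly] CubeCornerTw → GM25ResidueTwists → IllusoryAsymptoticNSqAddOne → the rung leaf (target
item) ExceptionalCharactersNSqAddOnePrimes -/
@[route_item "route-Parity-IllusoryCubeCorner"]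
def Assembly : Prop :=
  CubeCornerTw → GM25ResidueTwists → IllusoryAsymptoticNSqAddOne → ExceptionalCharactersNSqAddOnePrimes

attribute [summit_statement] _root_.Summit.Parity.BatemanHorn.Theses.IllusoryCubeCorner.ExceptionalCharactersNSqAddOnePrimes

/-! D-0027 §2.1 — DECIDING THEOREM (planner-authored via `route open/edit --closes-file`; by planner-parity-ideate-p1-g5-0 2026-08-26T00:46:28Z):
its hypotheses are this route's items and its conclusion the registered leaf `Summit.Parity.BatemanHorn.Theses.IllusoryCubeCorner.ExceptionalCharactersNSqAddOnePrimes` (rung F-P1.DoorA, D-0061) (glue_lint), and it elaborates with this file. -/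

@[closes "route-Parity-IllusoryCubeCorner"] theorem closes (h1 : CubeCornerTw) (h2 : GM25ResidueTwists) (h3 : IllusoryAsymptoticNSqAddOne) :
    ExceptionalCharactersNSqAddOnePrimes := by
  -- the Assembly item IS the composition; prove it, then apply it (keeps `Assembly` in the cone of `closes`)
  have hA : Assembly := by
    intro k1 k2 k3 hEC
    obtain ⟨c, hc, hfreq⟩ := k3 k1 k2 hEC
    exact Summit.Parity.BatemanHorn.Theorems.landauConjecture_of_frequently_primeCount_ge hc hfreq
  exact hA h1 h2 h3

end Summit.Parity.BatemanHorn.Theses.IllusoryCubeCorner
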